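/-
Copyright (c) 2026. All rights reserved.
Released under Apache 2.0 license as described in the file LICENSE.
-/
import Summits.HubbardSuperconductivity.HubbardLadder.HubbardDopedDoubleOccRows
import Summits.HubbardSuperconductivity.HubbardLadder.HubbardMomentRows
import HarnessLib

/-!
# R2 rows (device D21, part 2): the local moment and the staggered-magnetisation ceiling of the
# DOPED `4 × 4` Hubbard torus (`N = 14`, `n = 7/8`, `t' = 0`; `U = 4, 8`)

HONEST FRAMING: ladder R1–R4 with certified numbers; no claim on H/H₀.

Cell `pub-hubbard`, seat r2, R2-TABLE §C (rows C1m / C1m′). Companion of `HubbardDopedDoubleOccRows`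
(device D21, part 1: the double-occupancy windows `d ∈ [0.0347, 0.1290]` at `U = 4` and
`d ∈ [0, 0.0742]` at `U = 8` for normalised ground states of `H(1,U)` on the `4 × 4` torus in the
sector `N = 14`). The two kernels of `HubbardMomentRows` (device D8 companion; both PROVED for every
particle number `N`) turn them into rows for two benchmark spin observables (OBSERVABLES.md §3):

* the LOCAL MOMENT `m_loc := ⟨ψ, Σ_x (n_{x↑} - n_{x↓})² ψ⟩/16 = (N - 2⟨D⟩)/16 = n - 2d`
  (`re_expect_localMomentFour`): `m_loc ∈ [0.6170, 0.8056]` at `U = 4`, `m_loc ∈ [0.7266, 0.875]` at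
  `U = 8` (upper end `= n = 7/8` exactly: operator positivity of `D`);
* the STAGGERED MAGNETISATION squared `m_s² := ⟨ψ, Σ_{x,y} ε_x ε_y 𝐒_x·𝐒_y ψ⟩/256` through the
  moment-depletion ceiling `⟨𝓢⟩ ≤ 5 (N - 2⟨D⟩)` (`re_expect_stagStructureFour_le`, the `k = 8` Casimir
  bound of `FermionSpinMoment` on the `4 × 4` torus): the CERTIFICATE-FREE ceiling
  `m_s² ≤ 35/128 = 0.2734375` for EVERY normalised `14`-particle vector, and `m_s² ≤ 0.2518` for
  ground states at `U = 4` (∘ the certified `d ≥ 0.0347`). At `U = 8` the certified lower end of `d`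
  is `0`, so the ground-state ceiling there is the certificate-free one.

Certificate nodes (typed, `Bounds/TorusDopedN14Rows`, entering BY NAME as hypotheses exactly as in
part 1): `torusUpper_mbbootB2_4x4_U4_N14`, `torusLower_mbboot_4x4_U8_N14` (the `U = 4` rows),
`torusLower_mbboot_4x4_U4_N14`, `torusUpper_mbbootE2_4x4_U8_N14` (the `U = 8` row); or the signed
R1 row Props `r1Row_4x4_U{4,8}_N14_tp0` (`…_of_r1Rows`).

| `U` | `m_loc = 7/8 - 2d`     | `m_s²`                         |
|-----|------------------------|--------------------------------|
| any | —                      | `≤ 35/128` (every unit `ψ`, `N = 14`) |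
| 4   | `[0.6170, 0.8056]`     | `≤ 0.2518`                     |
| 8   | `[0.7266, 0.875]`      | `≤ 35/128`                     |

Comparators (context only): the half-filled `4 × 4` rows of R2-TABLE §B (`m_loc ∈ [0.7156, 0.8434]`
at `U = 4`, `[0.8346, 0.9362]` at `U = 8`, `HubbardRowsOfClaims`); no held source tabulates `m_loc`
or `S(π,π)` for the `4 × 4` torus at `N = 14`. HONEST LABEL: WEAK (ED-able cluster; the `m_s²`
ceilings are the Casimir bound barely sharpened and carry no information on Néel order at `n = 7/8`).

## References

* J. E. Hirsch, Phys. Rev. B 31 (1985) 4403, Table II, eq. (4.7) (local moment, `S(π,π)` on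
  `4 × 4`). [cite: HirschPRB1985, Table II]
* H. Tasaki, *Physics and Mathematics of Quantum Many-Body Systems* (2020), App. A.3 (spin
  Casimir bounds). [cite: Tasaki2020, App. A.3]
* T. Koma, H. Tasaki, J. Stat. Phys. 76 (1994) 745, §1. [cite: KomaTasaki1994, §1]
-/

noncomputable section

namespace Summit.HubbardSuperconductivity.HubbardLadder

open Literature.MathematicalPhysics.QuantumLattice Literature.Probability.LatticeModels Matrix
open Bounds

/-! ### Local moment `m_loc = ⟨M⟩/16 = 7/8 - 2d`, `N = 14` -/

/-- **R2 row C1m′ (`U = 4`, `N = 14`), claim form**: `m_loc ∈ [0.6170, 0.8056]`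
(= `7/8 - 2d` with `d ∈ [0.0347, 0.1290]` of `doubleOcc_four_N14_U4_mem_Icc_of_claims`).
[cite: HirschPRB1985, Table II][cite: KomaTasaki1994, §1] -/
theorem localMoment_four_N14_U4_mem_Icc_of_claims {ψ : Fock (Orb (FermionTorus 2 4))}
    (hψ : IsGroundState (hamiltonian (fermionTorusGraph 2 4) 1 4) 14 ψ) (hψ1 : star ψ ⬝ᵥ ψ = 1)
    (h₄ : torusUpper_mbbootB2_4x4_U4_N14) (h₈ : torusLower_mbboot_4x4_U8_N14) :
    (expect localMomentFour ψ).re / 16 ∈ Set.Icc (0.6170 : ℝ) 0.8056 := by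
  obtain ⟨h1, h2⟩ := doubleOcc_four_N14_U4_mem_Icc_of_claims hψ hψ1 h₄ h₈
  rw [re_expect_localMomentFour hψ.1 hψ1]
  constructor <;> push_cast <;> linarith

/-- **R2 row C1m′ from the two signed R1 doped calibration rows**: `m_loc ∈ [0.6170, 0.8056]`.
[cite: HirschPRB1985, Table II] -/
theorem localMoment_four_N14_U4_mem_Icc_of_r1Rows {ψ : Fock (Orb (FermionTorus 2 4))}
    (hψ : IsGroundState (hamiltonian (fermionTorusGraph 2 4) 1 4) 14 ψ) (hψ1 : star ψ ⬝ᵥ ψ = 1)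
    (h₄ : r1Row_4x4_U4_N14_tp0) (h₈ : r1Row_4x4_U8_N14_tp0) :
    (expect localMomentFour ψ).re / 16 ∈ Set.Icc (0.6170 : ℝ) 0.8056 := by
  obtain ⟨h1, h2⟩ := doubleOcc_four_N14_U4_mem_Icc_of_r1Rows hψ hψ1 h₄ h₈
  rw [re_expect_localMomentFour hψ.1 hψ1]
  constructor <;> push_cast <;> linarith

/-- **R2 row C1m (`U = 8`, `N = 14`), claim form**: `m_loc ∈ [0.7266, 0.875]` (= `7/8 - 2d` with
`d ∈ [0, 0.0742]`; the upper end is `n = 7/8` exactly, from operator positivity of `D`).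
[cite: HirschPRB1985, Table II][cite: KomaTasaki1994, §1] -/
theorem localMoment_four_N14_U8_mem_Icc_of_claims {ψ : Fock (Orb (FermionTorus 2 4))}
    (hψ : IsGroundState (hamiltonian (fermionTorusGraph 2 4) 1 8) 14 ψ) (hψ1 : star ψ ⬝ᵥ ψ = 1)
    (h₄ : torusLower_mbboot_4x4_U4_N14) (h₈ : torusUpper_mbbootE2_4x4_U8_N14) :
    (expect localMomentFour ψ).re / 16 ∈ Set.Icc (0.7266 : ℝ) 0.875 := by
  obtain ⟨h1, h2⟩ := doubleOcc_four_N14_U8_mem_Icc_of_claims hψ hψ1 h₄ h₈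
  rw [re_expect_localMomentFour hψ.1 hψ1]
  constructor <;> push_cast <;> linarith

/-- **R2 row C1m from the two signed R1 doped calibration rows**: `m_loc ∈ [0.7266, 0.875]`.
[cite: HirschPRB1985, Table II] -/
theorem localMoment_four_N14_U8_mem_Icc_of_r1Rows {ψ : Fock (Orb (FermionTorus 2 4))}
    (hψ : IsGroundState (hamiltonian (fermionTorusGraph 2 4) 1 8) 14 ψ) (hψ1 : star ψ ⬝ᵥ ψ = 1)
    (h₄ : r1Row_4x4_U4_N14_tp0) (h₈ : r1Row_4x4_U8_N14_tp0) :
    (expect localMomentFour ψ).re / 16 ∈ Set.Icc (0.7266 : ℝ) 0.875 := by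
  obtain ⟨h1, h2⟩ := doubleOcc_four_N14_U8_mem_Icc_of_r1Rows hψ hψ1 h₄ h₈
  rw [re_expect_localMomentFour hψ.1 hψ1]
  constructor <;> push_cast <;> linarith

/-! ### Staggered magnetisation ceiling `m_s² = ⟨𝓢⟩/256`, `N = 14` -/

/-- **Row C.S₀ (certificate-free, every `U`)**: every normalised `14`-particle vector of the
`4 × 4` torus has `m_s² = ⟨𝓢⟩/256 ≤ 35/128` (moment-depletion ceiling `⟨𝓢⟩ ≤ 5(N - 2⟨D⟩)` with
`⟨D⟩ ≥ 0`). [cite: Tasaki2020, App. A.3] -/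
theorem stagMagSq_four_N14_le {ψ : Fock (Orb (FermionTorus 2 4))} (hN : IsNParticle 14 ψ)
    (hψ1 : star ψ ⬝ᵥ ψ = 1) : (expect stagStructureFour ψ).re / 256 ≤ 35 / 128 := by
  have h := re_expect_stagStructureFour_le hN hψ1
  have hD := doubleOcc_four_nonneg ψ
  push_cast at h
  rw [div_le_iff₀ (by norm_num : (0 : ℝ) < 256)]
  linarith

/-- **R2 row C1m′.S (`U = 4`, `N = 14`), claim form**: `m_s² ≤ 0.2518` for ground states
(∘ the certified `d ≥ 0.0347` of part 1). [cite: Tasaki2020, App. A.3][cite: KomaTasaki1994, §1] -/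
theorem stagMagSq_four_N14_U4_le_of_claims {ψ : Fock (Orb (FermionTorus 2 4))}
    (hψ : IsGroundState (hamiltonian (fermionTorusGraph 2 4) 1 4) 14 ψ) (hψ1 : star ψ ⬝ᵥ ψ = 1)
    (h₄ : torusUpper_mbbootB2_4x4_U4_N14) (h₈ : torusLower_mbboot_4x4_U8_N14) :
    (expect stagStructureFour ψ).re / 256 ≤ 0.2518 := by
  have hd := (doubleOcc_four_N14_U4_mem_Icc_of_claims hψ hψ1 h₄ h₈).1
  have h := re_expect_stagStructureFour_le hψ.1 hψ1
  push_cast at h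
  rw [div_le_iff₀ (by norm_num : (0 : ℝ) < 256)]
  linarith

/-- **R2 row C1m′.S from the two signed R1 doped calibration rows**: `m_s² ≤ 0.2518` at `U = 4`.
[cite: Tasaki2020, App. A.3] -/
theorem stagMagSq_four_N14_U4_le_of_r1Rows {ψ : Fock (Orb (FermionTorus 2 4))}
    (hψ : IsGroundState (hamiltonian (fermionTorusGraph 2 4) 1 4) 14 ψ) (hψ1 : star ψ ⬝ᵥ ψ = 1)
    (h₄ : r1Row_4x4_U4_N14_tp0) (h₈ : r1Row_4x4_U8_N14_tp0) :
    (expect stagStructureFour ψ).re / 256 ≤ 0.2518 := by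
  have hd := (doubleOcc_four_N14_U4_mem_Icc_of_r1Rows hψ hψ1 h₄ h₈).1
  have h := re_expect_stagStructureFour_le hψ.1 hψ1
  push_cast at h
  rw [div_le_iff₀ (by norm_num : (0 : ℝ) < 256)]
  linarith

end Summit.HubbardSuperconductivity.HubbardLadder

end
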